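import Summits.AtomisticToContinuum.FouriersLaw.Theorems.OddSectorIrreversibilityConeScaleCorrectorStubConeTransportBudget
import Summits.AtomisticToContinuum.FouriersLaw.Theorems.OddSectorIrreversibilityOddCorrectorDecayKoopman

/-!
# `ConeScaleCorrector` (E1), line Sketch: the Cauchy–Schwarz (`√N`) form of the corrector/current pairing

Support file for crux stmt-AtomisticToContinuum-14069 (`OddSectorIrreversibility.ConeScaleCorrector`), line
Sketch (card `memory-time-bootstrap`), registered sub-goal `stub_correctorWitnessBound_sqrtN`. The line's jaw (W)
`stub_correctorWitnessBound` — the `N`-UNIFORM corrector-level witness inequality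
`∫ u·J_tot dμ_T ≤ K₁‖u‖_{L²(μ_T)}√Z + K₂Z` (`μ_T = OddSectorLocality.gibbsWeight`, mass `Z`) — is NOT proved
here: its only derivation in the tree is the corrector-level step of
`OddSectorWitness.TapLeak.response_bound_of_tapLeak` (`…WitnessGlueTapLeakBlock.lean`), whose window norm is
controlled only by the open crux `SubBallisticWindow` (stmt-14070) and whose leak rate only by the open crux
`TapLeakBound` (stmt-15159). What IS unconditional: one Cauchy–Schwarz against `J_tot`
(`integral_corrector_mul_current_le_sqrt`: `∫ u·J_tot dμ_T ≤ ‖u‖·√M_N`) and the landed `N`-uniform statics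
`exists_const_currentNormSq_le` (`M_N ≤ K·N·Z`) give `stub_correctorWitnessBound_sqrtN`:
`∫ u·J_tot dμ_T ≤ K·√N·‖u‖_{L²(μ_T)}·√Z` for all `N` and all `u ∈ L²(μ_T)` — one factor `√N` short of (W)
(with the memory-time jaw (M) it yields `‖u‖² ≲ N³Z`, not E1's `N²Z`). Nothing here closes the crux.
-/

noncomputable section

open MeasureTheory ProbabilityTheory Filter Topology Set
open scoped ENNReal NNReal BigOperators
open Literature.MathematicalPhysics.KineticTheory.HeatConduction
open Literature.MathematicalPhysics.KineticTheory.OddSectorLocality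

namespace Summit.AtomisticToContinuum.FouriersLaw.Theorems.OddSectorIrreversibility

open Summit.AtomisticToContinuum.FouriersLaw.Theorems.OddResponseBound.Negative.OddPairing

variable {ω₂ lam β T : ℝ}

/-- **Cauchy–Schwarz against the total current** (fixed `N`): `∫ u·J_tot dμ_T ≤ ‖u‖_{L²(μ_T)}·√M_N` for every
`u ∈ L²(μ_T)`, `M_N = currentNormSq` (`J_tot ∈ L²(μ_T)` by `ClosedChainKoopman.memLp_two_totalCurrent`). [folklore] -/
theorem integral_corrector_mul_current_le_sqrt (hω : 0 < ω₂) (hl : 0 ≤ lam) (hβ : 0 ≤ β) (γ : ℝ) (N : ℕ)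
    (hT : 0 < T) {u : PhaseSpace N → ℝ} (hu : MemLp u 2 (gibbsWeight ω₂ lam β γ T N)) :
    ∫ x, u x * (∑ i : Fin N, (pinnedChain ω₂ lam β γ).bondCurrent N i x) ∂(gibbsWeight ω₂ lam β γ T N) ≤
      Real.sqrt (∫ x, (u x) ^ 2 ∂(gibbsWeight ω₂ lam β γ T N)) *
        Real.sqrt (currentNormSq ω₂ lam β γ T N) := by
  have h := Real.abs_le_sqrt (sq_integral_mul_le hu (ClosedChainKoopman.memLp_two_totalCurrent hω hl hβ γ N hT))
  rw [Real.sqrt_mul (integral_nonneg fun _ => sq_nonneg _)] at h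
  exact (le_abs_self _).trans h

/-- **`stub_correctorWitnessBound_sqrtN`**: there is `K ≥ 0` (depending on `ω₂, lam, β, T` only) with
`∫ u·J_tot dμ_T ≤ K·√N·‖u‖_{L²(μ_T)}·√Z` for every `N` and every `u ∈ L²(μ_T)` (`Z = ∫ e^{-H/T}`) —
`integral_corrector_mul_current_le_sqrt` and the landed statics `M_N ≤ K·N·Z` (`exists_const_currentNormSq_le`);
one factor `√N` short of the line's jaw (W) `stub_correctorWitnessBound`. [folklore] -/
theorem stub_correctorWitnessBound_sqrtN :
    ∀ ω₂ lam β γ : ℝ, 0 < ω₂ → 0 ≤ lam → 0 ≤ β → ∀ T : ℝ, 0 < T → ∃ K : ℝ, 0 ≤ K ∧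
      ∀ (N : ℕ) (u : Literature.MathematicalPhysics.KineticTheory.HeatConduction.PhaseSpace N → ℝ),
      MeasureTheory.MemLp u 2 (Literature.MathematicalPhysics.KineticTheory.OddSectorLocality.gibbsWeight ω₂ lam β γ T N) →
      ∫ x, u x * (∑ i : Fin N,
          (Literature.MathematicalPhysics.KineticTheory.HeatConduction.pinnedChain ω₂ lam β γ).bondCurrent N i x)
          ∂(Literature.MathematicalPhysics.KineticTheory.OddSectorLocality.gibbsWeight ω₂ lam β γ T N) ≤
        K * Real.sqrt (N : ℝ) *
          Real.sqrt (∫ x, (u x) ^ 2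
            ∂(Literature.MathematicalPhysics.KineticTheory.OddSectorLocality.gibbsWeight ω₂ lam β γ T N)) *
          Real.sqrt (∫ x, Real.exp
            (-((Literature.MathematicalPhysics.KineticTheory.HeatConduction.pinnedChain ω₂ lam β γ).hamiltonian N x) / T)
            ∂MeasureTheory.volume) := by
  intro ω₂ lam β γ hω hl hβ T hT
  obtain ⟨K, hK0, hK⟩ := exists_const_currentNormSq_le hω hl hβ γ hT
  refine ⟨Real.sqrt K, Real.sqrt_nonneg _, fun N u hu => ?_⟩
  have h1 := integral_corrector_mul_current_le_sqrt hω hl hβ γ N hT hu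
  have h2 : Real.sqrt (currentNormSq ω₂ lam β γ T N) ≤ Real.sqrt K * Real.sqrt (N : ℝ) *
      Real.sqrt (∫ x, Real.exp (-((pinnedChain ω₂ lam β γ).hamiltonian N x) / T) ∂volume) := by
    rw [← Real.sqrt_mul hK0, ← Real.sqrt_mul (by positivity)]
    exact Real.sqrt_le_sqrt (hK N)
  calc _ ≤ _ := h1
    _ ≤ Real.sqrt (∫ x, (u x) ^ 2 ∂(gibbsWeight ω₂ lam β γ T N)) * (Real.sqrt K * Real.sqrt (N : ℝ) *
          Real.sqrt (∫ x, Real.exp (-((pinnedChain ω₂ lam β γ).hamiltonian N x) / T) ∂volume)) :=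
        mul_le_mul_of_nonneg_left h2 (Real.sqrt_nonneg _)
    _ = _ := by ring

end Summit.AtomisticToContinuum.FouriersLaw.Theorems.OddSectorIrreversibility

end
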